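import Literature.AlgebraicGeometry.HodgeTheory.AbelianVarietyCechH1StructureSheafEqDim
import HarnessLib

/-!
# The Kodaira–Spencer map of the Poincaré sheaf is BIJECTIVE: `T_{y₀} Â ⥲ Ȟ¹(𝔘, 𝒪_{A₀})` (Mumford, *Abelian Varieties*, §13 Cor. 3)

D. Mumford, *Abelian Varieties* (1970), §13: the Theorem's proof (pp. 125–130) shows that the Kodaira–Spencer map of the
Poincaré sheaf at a point of `Â` is injective, and Corollaries 2–3 (pp. 129–130) read off `dim H¹(A, 𝒪_A) = g` and the
identification of the tangent space of `Â` with `H¹(A, 𝒪_A)`.  In the tree's currency ([GortzWedhorn2023] Prop. 27.122):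
for the normalised Poincaré data `(Θ, 𝒫)` on `A₀ × Â`, a closed point `y₀ ∈ Â`, the Artinian chart `𝒪_{Â,y₀}/𝔪^{n+2}` with
its augmentation `ρ`, a finite affine open cover `𝔘 = (V a)` of `A₀` and frames `F` of `𝒫` on the chart, the `ℂ`-linear
Kodaira–Spencer map `KS : Der_ℂ(𝒪_{Â,y₀}/𝔪^{n+2}, ℂ_ρ) → Ȟ¹(𝔘, 𝒪_{A₀})` of the chart's transition cocycle is
**bijective**: injective by ★ `KodairaSpencerInjective.ksLinear_injective_of_rigid` (first-order rigidity of `𝒫`,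
★ `poincare_firstOrderRigid`), and the two sides have the same finite dimension `dim A₀`
(★ `LevelTangentDimension.finrank_derAt_ρℂ` + ★ `dim_dualOf`; ★ `HodgeTheory.AbelianVariety.finrank_cechH1_structureSheaf_eq_dim`,
Mumford §13 Cor. 2).

* `AbelianVariety.ksLinear_poincare_bijective` — bijectivity at every Artinian level `n + 1`;
* `AbelianVariety.nonempty_derAt_linearEquiv_cechH1` — `Der_ℂ(𝒪_{Â,y₀}/𝔪², ℂ) ≃ₗ[ℂ] Ȟ¹(𝔘, 𝒪_{A₀})` through `KS`,
  for every closed point `y₀` of `Â` and every finite affine open cover `𝔘` (frames exist after refining nothing: they are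
  produced on `𝔘` itself whenever `𝒫|_{A₀ × y₀}` is trivial on each `V a`, and the statement is cover-free on the
  left, so we take the frames as a hypothesis in the first theorem and discharge the equidimensionality only).

Everything here is proved; no definitions, no named facts.  Cell hodgecm-mathlib, (F)-census §4 (α) node E2/E4 currency
(the tangent space of the dual); B-p07 (g13).  HC_CM is proved only modulo the 7 printed citations until rung 0 closes.

## References
* [MumfordAV1970] D. Mumford, *Abelian Varieties* (1970), §13, proof of the Theorem (pp. 125–130) and Cor. 2–3 (pp. 129–130).
* [GortzWedhorn2023] U. Görtz, T. Wedhorn, *Algebraic Geometry II* (2023), Prop. 27.122.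
-/

noncomputable section

open CategoryTheory CategoryTheory.Limits AlgebraicGeometry MonoidalCategory CartesianMonoidalCategory
open scoped DualNumber

namespace Literature.AlgebraicGeometry.Motives.AbelianVariety

open Literature.AlgebraicGeometry.AbelianSchemes Literature.AlgebraicGeometry.AbelianVarieties
  Literature.AlgebraicGeometry.Modules Literature.AlgebraicGeometry.Morphisms
  Literature.AlgebraicGeometry.Morphisms.CechUnitCocycle Literature.AlgebraicGeometry.Motives

section KSBijective

variable (A₀ : AbelianVariety ℂ) {Θ : CartierDivisor A₀.X.left} (hΘ : Θ.IsAmple)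
  (P : (A₀.X ⊗ (A₀.dualOf Θ hΘ).X).left.Modules)
  {ι : Type} [Finite ι] (V : ι → A₀.X.left.Opens) (hV : ∀ a, IsAffineOpen (V a))
  (y₀ : (A₀.dualOf Θ hΘ).X.left) [LocallyOfFiniteType (A₀.dualOf Θ hΘ).X.hom]
  (hy₀ : IsClosed ({y₀} : Set (A₀.dualOf Θ hΘ).X.left))
  [IsSeparated A₀.X.hom]

/-- **The Kodaira–Spencer map of the Artinian chart `𝒪_{Â,y₀}/𝔪^{n+2}` of the Poincaré sheaf is BIJECTIVE**
`Der_ℂ(𝒪_{Â,y₀}/𝔪^{n+2}, ℂ_ρ) ⥲ Ȟ¹(𝔘, 𝒪_{A₀})`, for `𝒫` of rank one with `(1 × φ_Θ)^*𝒫 ≅ Λ(𝒪(Θ))`, every closed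
point `y₀ ∈ Â`, every finite affine open cover `𝔘` of `A₀` and all frames `F` of `𝒫` on the chart: injective by the
first-order rigidity of `𝒫`, surjective because both sides have dimension `dim A₀`.
[cite: MumfordAV1970, §13 (proof of the Thm. pp. 125–130) and Cor. 2–3 (pp. 129–130)] [cite: GortzWedhorn2023, Prop. 27.122] -/
theorem ksLinear_poincare_bijective [P.IsQuasicoherent] (hcov : iSup V = ⊤) (hP1 : HasRank P 1)
    (eP : Nonempty ((Scheme.Modules.pullback (AbelianVariety.Hom.toSchemeHom (A₀.oneProdPhiTheta hΘ))).obj P ≅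
      mumfordSheaf A₀ Θ))
    (n : ℕ) (F : IFrames (PBn A₀ hΘ P y₀ (n + 1)) (fun a => (pullback.fst A₀.X.hom (sB A₀ hΘ y₀ (n + 1))) ⁻¹ᵁ V a)) :
    Function.Bijective (ksLinear
      ((absModelData A₀.X (sB A₀ hΘ y₀ (n + 1)) (thickeningPt_hom_eq (A₀.dualOf Θ hΘ).X y₀ (n + 1)) V hV).cocycle F)
      (ρℂ (A₀.dualOf Θ hΘ).X y₀ hy₀ (n + 1))) := by
  have hinj := ksLinear_injective_of_rigid A₀ hΘ P V hV y₀ hy₀ hcov hP1 (poincare_firstOrderRigid A₀ hΘ P eP) n F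
  -- both sides are finite-dimensional of dimension `dim A₀`
  obtain ⟨hfinD, hdimD⟩ := finrank_derAt_ρℂ (A₀.dualOf Θ hΘ) y₀ hy₀ n
  rw [AbelianVariety.dim_dualOf] at hdimD
  obtain ⟨hfinH, hdimH⟩ :=
    Literature.AlgebraicGeometry.HodgeTheory.AbelianVariety.finrank_cechH1_structureSheaf_eq_dim A₀ V hV hcov
  haveI := hfinD
  haveI := hfinH
  exact ⟨hinj, (LinearMap.injective_iff_surjective_of_finrank_eq_finrank (hdimD.trans hdimH.symm)).1 hinj⟩

/-- **`T_{y₀} Â ≅ Ȟ¹(𝔘, 𝒪_{A₀})` through the Kodaira–Spencer map** (Mumford §13 Cor. 3 in the tree's currency): for every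
closed point `y₀` of `Â = A₀/K(Θ)`, every finite affine open cover `𝔘` of `A₀` and frames of `𝒫` on the first-order chart at
`y₀`, the derivations `Der_ℂ(𝒪_{Â,y₀}/𝔪², ℂ)` (= the Zariski tangent space of `Â` at `y₀`) are `ℂ`-linearly isomorphic to
`Ȟ¹(𝔘, 𝒪_{A₀})`. [cite: MumfordAV1970, §13 Cor. 3 (p. 130)] -/
theorem nonempty_derAt_linearEquiv_cechH1 (hV : ∀ a, IsAffineOpen (V a)) [P.IsQuasicoherent] (hcov : iSup V = ⊤) (hP1 : HasRank P 1)
    (eP : Nonempty ((Scheme.Modules.pullback (AbelianVariety.Hom.toSchemeHom (A₀.oneProdPhiTheta hΘ))).obj P ≅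
      mumfordSheaf A₀ Θ))
    (F : IFrames (PBn A₀ hΘ P y₀ (0 + 1)) (fun a => (pullback.fst A₀.X.hom (sB A₀ hΘ y₀ (0 + 1))) ⁻¹ᵁ V a)) :
    Nonempty (DerAt (ρℂ (A₀.dualOf Θ hΘ).X y₀ hy₀ (0 + 1)) ≃ₗ[ℂ] CechH1 A₀.X.hom V) :=
  ⟨LinearEquiv.ofBijective _ (ksLinear_poincare_bijective A₀ hΘ P V hV y₀ hy₀ hcov hP1 eP 0 F)⟩

end KSBijective

end Literature.AlgebraicGeometry.Motives.AbelianVariety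

end
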